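import Summits.ResolutionOfSingularities.ResolutionOfSingularities.Theorems.WildCocycleLU3
import HarnessLib
/-!
# WildCocycleLU (4/4) — KERNEL TOYS (pencil tops, Artin–Schreier pencil), the located residual `R35`, the cut `R34 ↔ R35`, ROOT BY NAME

Node «CocycleCut» (decomp-res lens-1 g34), tree file 4/4.

* TOY A (the grade-1 NON-`λ′` inhabitant, BRIESKORN–PHAM / KUMMER PENCIL TOP, any `p`): `F = Σ x_i^{a_i}`,
  `a_i b_i = M`, `w^M = 1 + F`, `g x_i = x_i / w^{b_i}`: the PENCIL IDENTITY `gF = F/w^M = F/(1 + F)` — the pencil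
  parameter runs through the SAME Möbius orbit `toyEta F n = F/(1 + nF)` as g32/g33's pivot (closed form for all `n`,
  period `p` in characteristic `p`); the principal unit `w = 1 + η` has `η · Σ_{j<M} w^j = F` (`η = F·unit`: the single
  unit is NOT a monomial pivot — `F ∈ 𝔪²` is a prime of the model); NORM ONE telescopes (`w_n = (1 + nF)^{1/M}`,
  `gⁱw = w_{i+1}/w_i`, `∏_{i<p} w_{i+1}/w_i = w_p/w_0`).
* TOY B (the grade-2 TEST DATA, two-pivot top `g x_i = x_i/(1 + x_i)`, `i = 1, 2`, any `p`): with `s_i = 1/x_i`,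
  `g s_i = s_i + 1`; the Artin–Schreier invariants `T_i = ℘(s_i) = s_i^p − s_i` (`X = 1/T₁ = x₁^p/(1 − x₁^{p−1})`),
  the mixed invariant `D = s₂ − s₁` with `D^p = D + (T₂ − T₁)`, and the ARTIN–SCHREIER-PENCIL RELATION
  `Z^p − (XY)^{p−1} Z = (XY)^{p−1}(X − Y)` for `Z = XYD` (`p = 2`: Artin's `D₄¹` form `Z² + XYZ + X²Y + XY² = 0`).
  RANK EXACTLY 2 (paper proof, `B = k[x₁,x₂,x₃]_𝔪`, `g x₃ = x₃`): restrict a relation `u₁^a u₂^b = gφ/φ` (`φ ∈ B^×`,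
  `u_i = g x_i/x_i = 1/(1 + x_i)`) to the `g`-STABLE AXIS `x₂ = x₃ = 0`: there `u₂ ↦ 1` and `g s = s + 1`, `u₁ = s/(s + 1)`
  (`s = 1/x₁`), so the relation reads `φ̄(s+1) (s+1)^a = φ̄(s) s^a`, i.e. `ψ = φ̄ s^a` is `g`-INVARIANT: `ψ ∈ k(s)^g = k(℘ s)`
  has `s`-degree `≡ 0 (mod p)`; a unit `φ̄` has `s`-degree `0`, whence `p ∣ a`; symmetrically (axis `x₁ = x₃ = 0`) `p ∣ b`.
* `R35 := R34 ∧ ¬λ₁` (`NonKHToricArchLUKeyHenselDescentQuotTInertTwoMBWildLDTTCy`), the cell piece (DECIDED by the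
  law `relLU_of_wildLogCyclicAbove`), `R34 → R35`, the ONE exact cut `R34 ↔ R35`, `_of_root`, `closes_cocycle`
  (EXACTLY `closes_twistedToric`'s five printed binders with `R34 ↦ R35`).
  HONEST SCOPE: `λ₁ ⊇ λ′` strictly on models (pencil tops); at the level of PLACES the enlargement is a CANDIDATE
  (re-pivoting = embedded LU of `{F = 0}` along `v′`, open for `d ≥ 4`).  By the EXACT CARVE (file 3) the located
  remainder of the log-diagonal world inside `R35` IS `λ₂ = WildLogRankTwoAbove` (grade ≥ 2; UNDECIDED, test data
  I176 (c″)); (β′), (β″), (γ), (B′), (α3′) as located in R32–R34.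
-/

noncomputable section
open Literature.AlgebraicGeometry.Resolution
open Summit.ResolutionOfSingularities.ResolutionOfSingularities.Theorems.WildLogDiagonalLU
open Summit.ResolutionOfSingularities.ResolutionOfSingularities.Theorems.WildTwistedToricLU

universe u

namespace Summit.ResolutionOfSingularities.ResolutionOfSingularities.Theorems.WildCocycleLU

/-! ## TOY A — the Brieskorn–Pham / Kummer pencil top (grade 1, not `λ′`) -/
section ToyPencil

variable {E : Type u} [Field E]

/-- **PENCIL IDENTITY.**  `g x_i = x_i / w^{b_i}`, `a_i b_i = M` ⇒ `gF = Σ (x_i/w^{b_i})^{a_i} = F / w^M`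
(`F = Σ x_i^{a_i}`). [folklore] -/
theorem toy_pencil_apply {m : ℕ} (x : Fin m → E) (a b : Fin m → ℕ) (M : ℕ) (hab : ∀ i, a i * b i = M)
    (w : E) : ∑ i, (x i / w ^ b i) ^ a i = (∑ i, x i ^ a i) / w ^ M := by
  rw [Finset.sum_div]
  refine Finset.sum_congr rfl fun i _ => ?_
  rw [div_pow, ← pow_mul, mul_comm, hab i]

/-- **THE PENCIL PARAMETER MOVES ALONG THE MÖBIUS ORBIT**: with `w^M = 1 + F`, `gF = F/(1 + F) = toyEta F 1` —
the orbit of g32/g33's pivot `η`. [folklore] -/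
theorem toy_pencil_orbit {m : ℕ} (x : Fin m → E) (a b : Fin m → ℕ) (M : ℕ) (hab : ∀ i, a i * b i = M)
    (w : E) (hw : w ^ M = 1 + ∑ i, x i ^ a i) :
    ∑ i, (x i / w ^ b i) ^ a i = toyEta (∑ i, x i ^ a i) 1 := by
  rw [toy_pencil_apply x a b M hab w, hw, toyEta_one]

/-- **CLOSED FORM OF THE ORBIT** `gⁿη = η/(1 + nη)` for every `n` (the denominators `1 + iη`, `i ≤ n`, nonzero). [folklore] -/
theorem toyEta_closed_form (η : E) (n : ℕ) (h : ∀ i : ℕ, i ≤ n → 1 + (i : E) * η ≠ 0) :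
    toyEta η n = η / (1 + n * η) := by
  induction n with
  | zero => simp [toyEta]
  | succ n ih =>
    have hn : 1 + (n : E) * η ≠ 0 := h n (Nat.le_succ n)
    have ih' := ih fun i hi => h i (hi.trans (Nat.le_succ n))
    show toyEta η n / (1 + toyEta η n) = _
    rw [ih']
    have e : 1 + η / (1 + n * η) = (1 + (n + 1 : ℕ) * η) / (1 + n * η) := by
      rw [add_div' _ _ _ hn]; congr 1; push_cast; ring
    rw [e, div_div_div_cancel_right₀ hn]

/-- **PERIOD `p`**: in characteristic `p` the orbit closes up after `p` steps, `g^p η = η` (`1 + pη = 1`). [folklore] -/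
theorem toyEta_char (p : ℕ) [CharP E p] (η : E) (h : ∀ i : ℕ, i ≤ p → 1 + (i : E) * η ≠ 0) :
    toyEta η p = η := by
  rw [toyEta_closed_form η p h, CharP.cast_eq_zero E p, zero_mul, add_zero, div_one]

/-- **THE SINGLE UNIT IS `F · unit`, NOT A MONOMIAL PIVOT**: `w^M = 1 + F` ⇒ `(w − 1) · Σ_{j<M} w^j = F`
(`Σ w^j ≡ M` is a unit when `p ∤ M`; `F = Σ x_i^{a_i} ∈ 𝔪²` is a prime of the pencil model). [folklore] -/
theorem toy_pencil_principal (w F : E) (M : ℕ) (hw : w ^ M = 1 + F) :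
    (w - 1) * ∑ j ∈ Finset.range M, w ^ j = F := by
  rw [mul_comm, geom_sum_mul, hw, add_sub_cancel_left]

/-- At `w = 1` the unit factor is `Σ_{j<M} 1 = M` (its residue: a unit iff `p ∤ M`). [folklore] -/
theorem toy_pencil_unit_residue (M : ℕ) : ∑ j ∈ Finset.range M, (1 : E) ^ j = M := by
  simp

/-- **NORM ONE TELESCOPES**: `gⁱ w = W (i+1) / W i` (`W n = (1 + nF)^{1/M}`, `W 0 = 1`) ⇒
`∏_{i<n} gⁱw = W n / W 0`. [folklore] -/
theorem toy_pencil_norm (W : ℕ → E) (hW : ∀ i, W i ≠ 0) (n : ℕ) :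
    ∏ i ∈ Finset.range n, W (i + 1) / W i = W n / W 0 := by
  induction n with
  | zero => rw [Finset.prod_range_zero, div_self (hW 0)]
  | succ n ih =>
    rw [Finset.prod_range_succ, ih, div_mul_div_comm, mul_comm (W n) (W (n + 1)), mul_div_mul_right _ _ (hW n)]

/-- … so `N(w) = W p / W 0 = 1` as soon as `W p = W 0` (`1 + pF = 1`). [folklore] -/
theorem toy_pencil_norm_eq_one (W : ℕ → E) (hW : ∀ i, W i ≠ 0) (p : ℕ) (hp : W p = W 0) :
    ∏ i ∈ Finset.range p, W (i + 1) / W i = 1 := by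
  rw [toy_pencil_norm W hW p, hp, div_self (hW 0)]

/-- **SMALLEST CASE** (`d = 2` cusp `F = x₁² + x₂³`, `a = (2,3)`, `M = 6`, `g x₁ = x₁/w³`, `g x₂ = x₂/w²`,
`w⁶ = 1 + F`): `gF = F/(1 + F) = toyEta F 1`. [folklore] -/
theorem toy_cusp_orbit (x₁ x₂ w : E) (hw : w ^ 6 = 1 + (x₁ ^ 2 + x₂ ^ 3)) :
    (x₁ / w ^ 3) ^ 2 + (x₂ / w ^ 2) ^ 3 = toyEta (x₁ ^ 2 + x₂ ^ 3) 1 := by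
  rw [toyEta_one, div_pow, div_pow, ← pow_mul, ← pow_mul, hw, ← add_div]

/-- … its single unit: `(w − 1)·(1 + w + ⋯ + w⁵) = F`. [folklore] -/
theorem toy_cusp_principal (x₁ x₂ w : E) (hw : w ^ 6 = 1 + (x₁ ^ 2 + x₂ ^ 3)) :
    (w - 1) * ∑ j ∈ Finset.range 6, w ^ j = x₁ ^ 2 + x₂ ^ 3 :=
  toy_pencil_principal w _ 6 hw

/-- … at the prime `p = 5` (`p ∤ M = 6`): the unit factor has residue `6 = 1 ≠ 0`. [folklore] -/
theorem toy_cusp_unit_residue_five [CharP E 5] : (∑ j ∈ Finset.range 6, (1 : E) ^ j) ≠ 0 := by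
  rw [toy_pencil_unit_residue]
  have h5 : ((5 : ℕ) : E) = 0 := CharP.cast_eq_zero E 5
  have h6 : ((6 : ℕ) : E) = 1 := by
    rw [show (6 : ℕ) = 5 + 1 from rfl, Nat.cast_add, h5, Nat.cast_one, zero_add]
  rw [h6]; exact one_ne_zero

/-- … and `g⁵ = id` on the pencil parameter at `p = 5`: `toyEta F 5 = F`. [folklore] -/
theorem toy_cusp_period_five [CharP E 5] (F : E) (h : ∀ i : ℕ, i ≤ 5 → 1 + (i : E) * F ≠ 0) :
    toyEta F 5 = F :=
  toyEta_char 5 F h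

end ToyPencil

/-! ## THE KEY LEMMA (kernel, abstract local ring): a pencil-type action admits NO pivot (`λ′`) presentation -/
section KeyLemma

open IsLocalRing

variable {B : Type u} [CommRing B] [IsLocalRing B]

/-- In a local ring of characteristic `p`, `Σ_{i<m} (1 + η)^i` is a UNIT for `η ∈ 𝔪` and `p ∤ m` (residue `m`). [folklore] -/
theorem isUnit_geom_sum_of_mem_maximalIdeal (p : ℕ) [Fact p.Prime] [CharP B p] {η : B}
    (hη : η ∈ maximalIdeal B) {m : ℕ} (hm : ¬ p ∣ m) : IsUnit (∑ i ∈ Finset.range m, (1 + η) ^ i) := by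
  have hmu : IsUnit (m : B) := by
    have hc : Nat.Coprime m p := ((Nat.Prime.coprime_iff_not_dvd Fact.out).2 hm).symm
    have := ((ZMod.isUnit_iff_coprime m p).2 hc).map (ZMod.castHom (dvd_refl p) B)
    rwa [map_natCast] at this
  have hdiff : (∑ i ∈ Finset.range m, (1 + η) ^ i) - (m : B) ∈ maximalIdeal B := by
    have e : (∑ i ∈ Finset.range m, (1 + η) ^ i) - (m : B) = ∑ i ∈ Finset.range m, ((1 + η) ^ i - 1) := by
      rw [Finset.sum_sub_distrib, Finset.sum_const, Finset.card_range, nsmul_eq_mul, mul_one]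
    rw [e]
    refine Ideal.sum_mem _ fun i _ => ?_
    have g := geom_sum_mul (1 + η) i
    rw [add_sub_cancel_left] at g
    rw [← g]
    exact Ideal.mul_mem_left _ _ hη
  by_contra hS
  have hS' : (∑ i ∈ Finset.range m, (1 + η) ^ i) ∈ maximalIdeal B := (mem_maximalIdeal _).2 (mem_nonunits_iff.2 hS)
  have hm' : (m : B) ∈ maximalIdeal B := by
    have := Ideal.sub_mem _ hS' hdiff
    rwa [sub_sub_cancel] at this
  exact mem_nonunits_iff.1 ((mem_maximalIdeal _).1 hm') hmu

/-- **DIVISIBILITY TRANSFER** (characteristic `p`): `θ` prime, `η ∈ 𝔪`, `θ ∤ z`, `n ≠ 0`,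
`θ ∣ z·((1 + η)^n − 1)` ⇒ `θ ∣ η` — write `n = p^v m`, `p ∤ m`:
`(1 + η)^n − 1 = ((1 + η)^m − 1)^{p^v} = (η·S)^{p^v}` with `S = Σ_{i<m}(1 + η)^i` a unit. [folklore] -/
theorem prime_dvd_of_dvd_mul_pow_sub_one (p : ℕ) [Fact p.Prime] [CharP B p] {θ : B} (hθ : Prime θ) {η : B}
    (hη : η ∈ maximalIdeal B) {z : B} (hz : ¬ θ ∣ z) {n : ℕ} (hn : n ≠ 0)
    (h : θ ∣ z * ((1 + η) ^ n - 1)) : θ ∣ η := by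
  obtain ⟨v, m, hpm, rfl⟩ := Nat.exists_eq_pow_mul_and_not_dvd hn p (Nat.Prime.one_lt Fact.out).ne'
  have e1 : (1 + η) ^ (p ^ v * m) - 1 = ((1 + η) ^ m - 1) ^ p ^ v := by
    rw [sub_pow_char_pow, one_pow, mul_comm, pow_mul]
  have e2 : (1 + η) ^ m - 1 = (∑ i ∈ Finset.range m, (1 + η) ^ i) * η := by
    have g := geom_sum_mul (1 + η) m
    rw [add_sub_cancel_left] at g
    exact g.symm
  rw [e1, e2, mul_pow] at h
  have hS := isUnit_geom_sum_of_mem_maximalIdeal p hη hpm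
  rcases hθ.dvd_or_dvd h with h1 | h2
  · exact absurd h1 hz
  rcases hθ.dvd_or_dvd h2 with h3 | h4
  · exact absurd (isUnit_of_dvd_unit (hθ.dvd_of_dvd_pow h3) hS) hθ.not_unit
  · exact hθ.dvd_of_dvd_pow h4

/-- A prime `θ ∈ 𝔪²` divides NO pivot `w·∏ y_j^{β_j}` with `w` a unit and every `y_j ∉ 𝔪²`. [folklore] -/
theorem not_prime_dvd_pivot {θ : B} (hθ : Prime θ) (hθ2 : θ ∈ (maximalIdeal B) ^ 2) {d : ℕ} {y : Fin d → B}
    (hy2 : ∀ j, y j ∉ (maximalIdeal B) ^ 2) {w : B} (hw : IsUnit w) (β : Fin d → ℕ) :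
    ¬ θ ∣ w * ∏ j, y j ^ β j := by
  intro h
  rcases hθ.dvd_or_dvd h with h1 | h2
  · exact hθ.not_unit (isUnit_of_dvd_unit h1 hw)
  obtain ⟨j, -, hj⟩ := (Prime.dvd_finsetProd_iff hθ _).1 h2
  obtain ⟨c, hc⟩ := hθ.dvd_of_dvd_pow hj
  exact hy2 j (by rw [hc]; exact Ideal.mul_mem_right c _ hθ2)

/-- **THE KEY LEMMA (kernel, abstract).**  Let `B` be a local ring of characteristic `p`, `θ ∈ 𝔪²` a PRIME
element with `(σ − 1)B ⊆ θB` (it suffices on the frame), and `y` a frame of elements OUTSIDE `𝔪²` (e.g. an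
r.s.p.).  Then `σ` admits NO pivot (`λ′`-type) presentation on `y`: `σ y_j = y_j (1 + η̃)^{N_j}` (`N_j ∈ ℤ`) with
`η̃ = w·∏ y_j^{β_j} ∈ 𝔪`, `w` a unit, and a moved coordinate is IMPOSSIBLE (divisibility transfer `θ ∣ η̃`, then
`θ ∣ w` or `θ ∣ y_j ∈ 𝔪 ∖ 𝔪²`).  APPLIED (paper) to the Brieskorn–Pham pencil tops (`θ = F` prime in the regular
`B`, `F ∈ 𝔪²`, `(g − 1)B ⊆ F·B`): they carry a `λ₁`-frame and NO `λ′`-frame — `λ₁ ⊋ λ′` on MODELS. [this node] -/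
theorem false_of_pivot_presentation (p : ℕ) [Fact p.Prime] [CharP B p] {θ : B} (hθ : Prime θ)
    (hθ2 : θ ∈ (maximalIdeal B) ^ 2) (σ : B → B) {d : ℕ} {y : Fin d → B} (hσ : ∀ j, θ ∣ σ (y j) - y j)
    (hy2 : ∀ j, y j ∉ (maximalIdeal B) ^ 2) {w : B} (hw : IsUnit w) (β : Fin d → ℕ) (u : Bˣ)
    (hu : (u : B) = 1 + w * ∏ j, y j ^ β j) (hη : w * ∏ j, y j ^ β j ∈ maximalIdeal B) (N : Fin d → ℤ)
    (hσy : ∀ j, σ (y j) = y j * ((u ^ N j : Bˣ) : B)) (hmoved : ∃ j, σ (y j) ≠ y j) : False := by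
  obtain ⟨i, hi⟩ := hmoved
  set η := w * ∏ j, y j ^ β j with hηdef
  have hyθ : ¬ θ ∣ y i := fun ⟨c, hc⟩ => hy2 i (by rw [hc]; exact Ideal.mul_mem_right c _ hθ2)
  have hσyθ : ¬ θ ∣ σ (y i) := fun h => hyθ (by
    have := dvd_sub h (hσ i)
    rwa [sub_sub_cancel] at this)
  refine not_prime_dvd_pivot hθ hθ2 hy2 hw β ?_
  obtain ⟨n, hn | hn⟩ := Int.eq_nat_or_neg (N i)
  · have hn0 : n ≠ 0 := by
      rintro rfl
      apply hi
      rw [hσy i, hn]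
      simp
    have hu' : ((u ^ n : Bˣ) : B) = (1 + η) ^ n := by rw [Units.val_pow_eq_pow_val, hu]
    refine prime_dvd_of_dvd_mul_pow_sub_one p hθ hη hyθ hn0 ?_
    have e : σ (y i) - y i = y i * ((1 + η) ^ n - 1) := by
      rw [hσy i, hn, zpow_natCast, hu']; ring
    exact e ▸ hσ i
  · have hn0 : n ≠ 0 := by
      rintro rfl
      apply hi
      rw [hσy i, hn]
      simp
    have hu' : ((u ^ n : Bˣ) : B) = (1 + η) ^ n := by rw [Units.val_pow_eq_pow_val, hu]
    refine prime_dvd_of_dvd_mul_pow_sub_one p hθ hη hσyθ hn0 ?_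
    have key : σ (y i) * ((u ^ n : Bˣ) : B) = y i := by
      rw [hσy i, hn, zpow_neg, zpow_natCast, mul_assoc, Units.inv_mul, mul_one]
    have e : y i - σ (y i) = σ (y i) * ((1 + η) ^ n - 1) := by
      rw [mul_sub, mul_one, ← hu', key]
    have h2 : θ ∣ y i - σ (y i) := by
      rw [← neg_sub]; exact dvd_neg.2 (hσ i)
    exact e ▸ h2

end KeyLemma

/-! ## TOY B — the two-pivot top: Artin–Schreier pencil invariants (grade 2 test data) -/
section ToyArtinSchreier

variable {E : Type u} [Field E]

/-- `g x = x/(1 + x)` ⇒ `g(1/x) = 1/x + 1`: the inverse pivot coordinate is an ARTIN–SCHREIER root variable.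
[folklore] -/
theorem toy_inv_pivot (x : E) (hx : x ≠ 0) : (x / (1 + x))⁻¹ = x⁻¹ + 1 := by
  rw [inv_div, add_div, div_self hx, one_div, add_comm]

/-- **`℘(s) = s^p − s` IS INVARIANT** under `s ↦ s + 1` in characteristic `p`. [folklore] -/
theorem toy_artinSchreier_invariant (p : ℕ) [Fact p.Prime] [CharP E p] (s : E) :
    (s + 1) ^ p - (s + 1) = s ^ p - s := by
  rw [add_pow_char, one_pow]; ring

/-- The invariant in the pivot coordinate: `1/℘(1/x) = x^p/(1 − x^{p−1})` (`X = N(x)·unit`). [folklore] -/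
theorem toy_X_closed_form (p : ℕ) (hp : 1 ≤ p) (x : E) (hx : x ≠ 0) (hx1 : 1 - x ^ (p - 1) ≠ 0) :
    ((x⁻¹) ^ p - x⁻¹)⁻¹ = x ^ p / (1 - x ^ (p - 1)) := by
  obtain ⟨n, rfl⟩ := Nat.exists_eq_add_of_le hp
  rw [Nat.add_sub_cancel_left] at hx1 ⊢
  have e : (x⁻¹) ^ (1 + n) - x⁻¹ = (1 - x ^ n) / x ^ (1 + n) := by
    rw [inv_pow]; field_simp; ring
  rw [e, inv_div]

/-- **THE MIXED INVARIANT** `D = s₂ − s₁` of two Artin–Schreier root variables is itself an Artin–Schreier root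
over the invariants: `D^p = D + (℘(s₂) − ℘(s₁))`. [folklore] -/
theorem toy_asPencil_root (p : ℕ) [Fact p.Prime] [CharP E p] (s₁ s₂ : E) :
    (s₂ - s₁) ^ p = (s₂ - s₁) + ((s₂ ^ p - s₂) - (s₁ ^ p - s₁)) := by
  rw [sub_pow_char]; ring

/-- **THE ARTIN–SCHREIER-PENCIL RELATION** (any exponent `n + 1`): `X = 1/T₁`, `Y = 1/T₂`, `Z = X Y D` with
`D^{n+1} = D + (T₂ − T₁) = D + (Y⁻¹ − X⁻¹)` satisfy `Z^{n+1} − (XY)^n Z = (XY)^n (X − Y)` — for `n + 1 = p` the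
invariant hypersurface of the two-pivot top through `Z = XY(1/x₂ − 1/x₁)`; NOT a twisted monomial relation.
[folklore] -/
theorem toy_asPencil_relation (n : ℕ) (X Y D : E) (hX : X ≠ 0) (hY : Y ≠ 0)
    (hD : D ^ (n + 1) = D + (Y⁻¹ - X⁻¹)) :
    (X * Y * D) ^ (n + 1) - (X * Y) ^ n * (X * Y * D) = (X * Y) ^ n * (X - Y) := by
  have e : X * Y * (Y⁻¹ - X⁻¹) = X - Y := by
    rw [mul_sub, mul_inv_cancel_right₀ hY, mul_assoc, mul_comm Y X⁻¹, ← mul_assoc, mul_inv_cancel₀ hX, one_mul]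
  rw [mul_pow, hD, pow_succ, ← e]
  ring

/-- `p = 2`: the relation is ARTIN's `D₄¹` normal form `Z² + XYZ + X²Y + XY² = 0`. [cite: Artin1975] -/
theorem toy_asPencil_D4_char2 [CharP E 2] (X Y Z : E) (h : Z ^ 2 - (X * Y) ^ 1 * Z = (X * Y) ^ 1 * (X - Y)) :
    Z ^ 2 + X * Y * Z + X ^ 2 * Y + X * Y ^ 2 = 0 := by
  have h2 : (2 : E) = 0 := by exact_mod_cast CharP.cast_eq_zero E 2
  rw [pow_one] at h
  linear_combination h + (X * Y * Z + X ^ 2 * Y) * h2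

end ToyArtinSchreier

/-! ## The located residual `R35`, the cut `R34 ↔ R35`, ROOT BY NAME -/
section CutCy

open Summit.ResolutionOfSingularities.ResolutionOfSingularities.Theses
open Summit.ResolutionOfSingularities.ResolutionOfSingularities.Theorems
open Summit.ResolutionOfSingularities.ResolutionOfSingularities.Theorems.KeyChainLU
open Summit.ResolutionOfSingularities.ResolutionOfSingularities.Theorems.HenselKeyChainLU
open Summit.ResolutionOfSingularities.ResolutionOfSingularities.Theorems.GaloisDescentLU
open Summit.ResolutionOfSingularities.ResolutionOfSingularities.Theorems.PfaffLine
open Summit.ResolutionOfSingularities.ResolutionOfSingularities.Theorems.ToricLadder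
open Summit.ResolutionOfSingularities.ResolutionOfSingularities.Theorems.KaplanskyLadder
open Summit.ResolutionOfSingularities.ResolutionOfSingularities.Theorems.PerronLadder
open Summit.ResolutionOfSingularities.ResolutionOfSingularities.Theorems.DefectlessLadder
open Summit.ResolutionOfSingularities.ResolutionOfSingularities.Theorems.WCut
open Summit.ResolutionOfSingularities.ResolutionOfSingularities.Theorems.TameQuotientLU
open Summit.ResolutionOfSingularities.ResolutionOfSingularities.Theorems.DecompositionDescentLU
open Summit.ResolutionOfSingularities.ResolutionOfSingularities.Theorems.InertDescentLU
open Summit.ResolutionOfSingularities.ResolutionOfSingularities.Theorems.TameInertialLU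
open Summit.ResolutionOfSingularities.ResolutionOfSingularities.Theorems.TameTwoStoreyLU
open Summit.ResolutionOfSingularities.ResolutionOfSingularities.Theorems.MonomialBlowupLU
open Summit.ResolutionOfSingularities.ResolutionOfSingularities.Theorems.WildReflectionLU

variable {k : Type} [Field k] {K : Type} [Field K] [Algebra k K]

/-- The `λ₁` CELL PIECE of the residual family (tag DECIDED by `relLU_of_wildLogCyclicAbove`):
R34's binders together with `λ₁` give relative local uniformization. -/
def NonKHToricArchLUKeyHenselDescentQuotTInertTwoMBWildLDTTCyCell (e c n : ℕ) : Prop :=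
  ∀ p : ℕ, p.Prime → ∀ (k K : Type) [Field k] [CharP k p] [Field K] [Algebra k K],
    Algebra.trdeg k K ≤ n → ∀ O : ValuationSubring K, Nonempty O.valuation.RankOne →
    (∀ y ∈ O, ∃ f : Polynomial k, f ≠ 0 ∧ Polynomial.aeval y f ∈ O.nonunits) →
    ¬ IsAbhyankarPlace O (algebraMap k K).fieldRange ⊤ →
    ¬ (∃ d : ℕ, d < n ∧ SepDenseBelow k O d) → ¬ ToricDenseBelow k O e → ¬ KHTopBelow k O c →
    ¬ KeyChainTopBelow k O → ¬ HenselKeyChainTopBelow k O → ¬ GaloisHenselDescentDatum k O →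
    ¬ TameQuotientLU.TameEquivariantLUAbove k O →
    ¬ DecompositionFieldLUAbove k O → ¬ DecWitnessLUAbove k O → ¬ UnramifiedWitnessLUAbove k O →
    ¬ TameInertialLUAbove k O → ¬ TameOverInertLUAbove k O → ¬ MonomialBlowupAbove k O →
    ¬ WildPseudoReflectionLUAbove k O → ¬ WildLogDiagonalLUAbove k O → ¬ WildLogDiagonalUnluckyAbove k O →
    WildLogCyclicAbove k O → RelLocalUniformization k K O

/-- THE LAW DECIDES THE `λ₁` PIECE outright (no port, no fact binder, every `d`, every `p`). [this node] -/
theorem nonKHToricArchLUKeyHenselDescentQuotTInertTwoMBWildLDTTCyCell_holds (e c n : ℕ) :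
    NonKHToricArchLUKeyHenselDescentQuotTInertTwoMBWildLDTTCyCell e c n :=
  fun _ _ _ _ _ _ _ _ _ _ _ _ _ _ _ _ _ _ _ _ _ _ _ _ _ _ _ _ _ hCy => relLU_of_wildLogCyclicAbove hCy

/-- **NEW LOCATED RESIDUAL `R35`** (tag UNDECIDED · WEAKER than the root · located at `(e, c, n) = (3, 3, 4)`):
R34's clauses AND: for NO Galois `ℤ/p`-layer `K′/K` (`p = char k`) with `G`-stable `O′` and residues in `k` does
every f.g. birational model admit above it a `G`-stable regular f.g. model with a frame on which some `g ∈ G` acts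
log-diagonally through ONE principal unit `1 + η`, `η ∈ 𝔪_B` arbitrary, with a moved coordinate (the kind
`λ₁ = WildLogCyclicAbove`: grade 1 of the cocycle-rank grading; `λ′ ⊆ λ₁`, so the older binder `¬λ′` is now implied).
KIND CONSUMED hypothesis-free, every `d`, every `p`, by `relLU_of_wildLogCyclicAbove`.  HONEST SCOPE OF THE CUT:
on MODELS `λ₁ ⊋ λ′` (Brieskorn–Pham pencil tops: no `λ′`-presentation in any frame); at the level of PLACES the
enlargement is a CANDIDATE (re-pivoting a pencil top = embedded local uniformization of `{F = 0}` along `v′`, open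
for `d ≥ 4`) — nothing more is claimed.  LOCATED REMAINDER inside the log-diagonal world, BY THE EXACT CARVE
`wildLogDiagonalMixedAbove_iff`: exactly `λ₂ = WildLogRankTwoAbove` (an `F_p`-independent pair of frame cocycles;
test data the two-pivot top, Artin–Schreier-pencil invariants) — UNDECIDED; (β′), (β″), (γ), (B′), (α3′) as in R32–R34.
[cite: KiralyLutkebohmert2013, Thm. 2, Ex. 6, Conj. 10] [cite: CossartPiltant2008, Lemma 9.4] [cite: Artin1975] -/
def NonKHToricArchLUKeyHenselDescentQuotTInertTwoMBWildLDTTCy (e c n : ℕ) : Prop :=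
  ∀ p : ℕ, p.Prime → ∀ (k K : Type) [Field k] [CharP k p] [Field K] [Algebra k K],
    Algebra.trdeg k K ≤ n → ∀ O : ValuationSubring K, Nonempty O.valuation.RankOne →
    (∀ y ∈ O, ∃ f : Polynomial k, f ≠ 0 ∧ Polynomial.aeval y f ∈ O.nonunits) →
    ¬ IsAbhyankarPlace O (algebraMap k K).fieldRange ⊤ →
    ¬ (∃ d : ℕ, d < n ∧ SepDenseBelow k O d) → ¬ ToricDenseBelow k O e → ¬ KHTopBelow k O c →
    ¬ KeyChainTopBelow k O → ¬ HenselKeyChainTopBelow k O → ¬ GaloisHenselDescentDatum k O →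
    ¬ TameQuotientLU.TameEquivariantLUAbove k O →
    ¬ DecompositionFieldLUAbove k O → ¬ DecWitnessLUAbove k O → ¬ UnramifiedWitnessLUAbove k O →
    ¬ TameInertialLUAbove k O → ¬ TameOverInertLUAbove k O → ¬ MonomialBlowupAbove k O →
    ¬ WildPseudoReflectionLUAbove k O → ¬ WildLogDiagonalLUAbove k O → ¬ WildLogDiagonalUnluckyAbove k O →
    ¬ WildLogCyclicAbove k O → RelLocalUniformization k K O

/-- Dropping the negated `λ₁` hypothesis: `R34 → R35`. [folklore] -/
theorem nonKHToricArchLUKeyHenselDescentQuotTInertTwoMBWildLDTTCy_of_twistedToric {e c n : ℕ}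
    (h : NonKHToricArchLUKeyHenselDescentQuotTInertTwoMBWildLDTT e c n) :
    NonKHToricArchLUKeyHenselDescentQuotTInertTwoMBWildLDTTCy e c n :=
  fun p hp k K _ _ _ _ hd O h1 h0 hA hnd hnt hnk hkey hH hG hT hDF hDW hU hI h2 hMB hW hL hL' _ =>
    h p hp k K hd O h1 h0 hA hnd hnt hnk hkey hH hG hT hDF hDW hU hI h2 hMB hW hL hL'

/-- **THE COCYCLE CUT** (kernel, exact, hypothesis-free): the g33 located residual `R34` is EQUIVALENT to its
part off the kind `λ₁` — on `λ₁` the law `relLU_of_wildLogCyclicAbove` decides (case split). [this node] -/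
theorem nonKHToricArchLUKeyHenselDescentQuotTInertTwoMBWildLDTT_iff_cocycle {e c n : ℕ} :
    NonKHToricArchLUKeyHenselDescentQuotTInertTwoMBWildLDTT e c n ↔
      NonKHToricArchLUKeyHenselDescentQuotTInertTwoMBWildLDTTCy e c n := by
  refine ⟨nonKHToricArchLUKeyHenselDescentQuotTInertTwoMBWildLDTTCy_of_twistedToric,
    fun h p hp k K _ _ _ _ hd O hr hz hA hnd hnt hnk hkey hH hG hT hDF hDW hU hI h2 hMB hW hL hL' => ?_⟩
  by_cases hCy : WildLogCyclicAbove k O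
  · exact relLU_of_wildLogCyclicAbove hCy
  exact h p hp k K hd O hr hz hA hnd hnt hnk hkey hH hG hT hDF hDW hU hI h2 hMB hW hL hL' hCy

/-- The new residual follows from the root outright (it is a WEAKER piece). [folklore] -/
theorem nonKHToricArchLUKeyHenselDescentQuotTInertTwoMBWildLDTTCy_of_root (hS : _root_.ResolutionOfSingularities)
    (e c n : ℕ) : NonKHToricArchLUKeyHenselDescentQuotTInertTwoMBWildLDTTCy e c n :=
  nonKHToricArchLUKeyHenselDescentQuotTInertTwoMBWildLDTTCy_of_twistedToric
    (nonKHToricArchLUKeyHenselDescentQuotTInertTwoMBWildLDTT_of_root hS e c n)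

/-- **`closes_cocycle` — ROOT BY NAME (binders PRINTED, = `closes_twistedToric`'s with `R34 ↦ R35`):**
`(hCP : CossartPiltant2019LU3)` the Cossart–Piltant dimension-3 floor (print) ·
`(hCJS : CossartJannsenSaito2020Embedded)` embedded resolution of excellent surfaces (named fact) ·
`(hAsc : KK05NCVAscent)` the Knaf–Kuhlmann (NC)+(V) ascent Π₁ (print) · `(hN : ∀ d ≥ 4, R35 3 3 d)` the located
residual OFF the thirteen cells (…, wild-pseudo-reflection, binomial-log-diagonal, `λ′` AND the cyclic-cocycle kind
`λ₁`) · `(h₃ : Valuative.PatchingRel)` the patching crux 0642 ⇒ `ResolutionOfSingularities`.  All thirteen cells are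
discharged INSIDE the kernel. [folklore] -/
theorem closes_cocycle (hCP : CossartPiltant2019LU3.{0}) (hCJS : CossartJannsenSaito2020Embedded.{0})
    (hAsc : KK05NCVAscent) (hN : ∀ d, 4 ≤ d → NonKHToricArchLUKeyHenselDescentQuotTInertTwoMBWildLDTTCy 3 3 d)
    (h₃ : Valuative.PatchingRel) : _root_.ResolutionOfSingularities :=
  closes_twistedToric hCP hCJS hAsc
    (fun d hd => nonKHToricArchLUKeyHenselDescentQuotTInertTwoMBWildLDTT_iff_cocycle.2 (hN d hd)) h₃

end CutCy

end Summit.ResolutionOfSingularities.ResolutionOfSingularities.Theorems.WildCocycleLU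

end
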